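import Summits.ResolutionOfSingularities.ResolutionOfSingularities.Theorems.EquisingularLiftEquisingularLiftNatEquinodalCoreSOfCores2
import Summits.ResolutionOfSingularities.ResolutionOfSingularities.Theorems.EquisingularLiftEquisingularLiftNatEquinodalSectionFrame
import Summits.ResolutionOfSingularities.ResolutionOfSingularities.Theorems.EquisingularLiftEquisingularLiftNatEquinodalAffineFrameDerivations
import Literature.AlgebraicGeometry.Resolution.DerivativeIdealsLocalization
import Literature.AlgebraicGeometry.Motives.VarietiesProjectiveSpaceProofs
import HarnessLib

/-!
# [OURS · L1 W4.5(b) · EL♮(3) · door ν4, N-0 core W5, piece W5b part 1] THE CHART FRAME AT A NODE SECTION HAS DUAL DERIVATIONS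
# ★ `exists_chart_frame_dual_derivations` (+ two folklore transport lemmas for `ℤ`-derivations)

res-L1-w45b-stub-2 g18 (W5b pen of record, desk g25-13). `--supports stmt-ResolutionOfSingularities-20148 --as helper`, no claim, counted 0. OURS; NOT a
statement of [Hironaka2017]; AI-written, weaker than expert review. EL♮(3) is NOT proved here; char-p resolution is NOT proved anywhere in this tree. DEF-FREE.

* `exists_derivation_transport`, `exists_derivation_extend_of_ringEquiv_of_isLocalization` — a `ℤ`-derivation moves along a ring isomorphism and extends
  to a localisation (Literature ✓ `exists_derivation_extend_of_isLocalization`). [folklore]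
* ★ `exists_chart_frame_dual_derivations` — binders = the `cores` binder list of ✓ `coreS_of_cores₂` (…NatEquinodalCoreSOfCores2 l.45–88) VERBATIM, then
  `i` and the degree certificate of the FRAME `(L̃, y₀ − n₀y₂, y₁ − n₁y₂)` at the node section `𝔰 i`: in the chart ring `T = O[t₁,t₂,t₃] ≅ (O[x]_{x_d})₀`
  (Literature `ProjectiveSpace.chartAlgEquiv`, `d = dv i`) the dehomogenised frame has DUAL `ℤ`-DERIVATIONS `E₁, E₂, E₃` (`E_j F_l = [j = l]`).  Proof: the
  frame is affine-linear with coefficient matrix `M` (`dehomogenize` of a linear form), it vanishes at the section point (`u · F(a) = (ψ̃ F)(n)`,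
  ✓ `SectionFrame.pow_mul_eval_eq_eval_aeval` / `mul_eval_sect`), and `t_m − a_m ∈ (F₀,F₁,F₂)` is the dehomogenisation of res-L1-w45b-stub-4's ✓
  `SectionFrame.span_X_sub_eq_span_frame`; then res-L1-w45b-stub-4's ✓ `SectionFrame.exists_dual_derivations_of_affine_frame` (H3). [OURS]
-/

set_option linter.dupNamespace false
set_option linter.overlappingInstances false -- signatures carry `[IsDomain O] [IsDiscreteValuationRing O]` (as ✓ coreS_of_cores₂)

noncomputable section

open CategoryTheory CategoryTheory.Limits AlgebraicGeometry TopologicalSpace Topology IsLocalRing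
open MvPolynomial HomogeneousLocalization
open Literature.AlgebraicGeometry.Resolution
open AlgebraicGeometry.Scheme.IdealSheafData
open Summit.ResolutionOfSingularities.ResolutionOfSingularities.Theses.EquisingularLift.Split
open Summit.ResolutionOfSingularities.ResolutionOfSingularities.Cruxes.EquisingularLift.StrataSplit

namespace Summit.ResolutionOfSingularities.ResolutionOfSingularities.Cruxes.EquisingularLiftNat.Sections.Equinodal

open Summit.ResolutionOfSingularities.ResolutionOfSingularities.Cruxes.EquisingularLiftNat.Sections

/-- Transport of a `ℤ`-derivation along a ring isomorphism (an existence statement; no definition is introduced). [folklore] -/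
theorem exists_derivation_transport {Γ T : Type*} [CommRing Γ] [CommRing T] (h : Γ ≃+* T) (E : Derivation ℤ T T) :
    ∃ E' : Derivation ℤ Γ Γ, ∀ c, E' c = h.symm (E (h c)) := by
  let L : Γ →ₗ[ℤ] Γ := (h.symm.toRingHom.toAddMonoidHom.comp (E.toLinearMap.toAddMonoidHom.comp h.toRingHom.toAddMonoidHom)).toIntLinearMap
  have hL : ∀ c, L c = h.symm (E (h c)) := fun _ => rfl
  refine ⟨Derivation.mk' L fun a b => ?_, fun c => rfl⟩
  rw [hL, hL, hL, map_mul, Derivation.leibniz, smul_eq_mul, smul_eq_mul, map_add, map_mul, map_mul, h.symm_apply_apply,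
    h.symm_apply_apply, smul_eq_mul, smul_eq_mul]

/-- **Derivations extend from a ring isomorphic to the base of a localisation**: for `A` a localisation of `Γ` and `h : Γ ≃ T`, every
`ℤ`-derivation of `T` induces one of `A` compatible with `T ≃ Γ → A` (Literature ✓ `exists_derivation_extend_of_isLocalization`). [folklore] -/
theorem exists_derivation_extend_of_ringEquiv_of_isLocalization {Γ T A : Type*} [CommRing Γ] [CommRing T] [CommRing A] [Algebra Γ A]
    (M : Submonoid Γ) [IsLocalization M A] (h : Γ ≃+* T) (E : Derivation ℤ T T) :
    ∃ δ : Derivation ℤ A A, ∀ z : T, δ (algebraMap Γ A (h.symm z)) = algebraMap Γ A (h.symm (E z)) := by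
  obtain ⟨E', hE'⟩ := exists_derivation_transport h E
  obtain ⟨δ, hδ⟩ := exists_derivation_extend_of_isLocalization ℤ A M E'
  refine ⟨δ, fun z => ?_⟩
  rw [hδ, hE', h.apply_symm_apply]

set_option maxHeartbeats 1600000 in -- budget line: the `cores₂` binder list (55 lines) makes every `whnf` of the goal expensive
/-- ★ **The dehomogenised frame `(L̃, y₀ − n₀y₂, y₁ − n₁y₂)/x_d` at a node section has dual derivations in the chart ring `O[t₁,t₂,t₃]`.**
Binders = the `cores` binder list of ✓ `coreS_of_cores₂` VERBATIM, then `i` and the frame's degree certificate. [OURS · W5b part 1; counted 0] -/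
theorem exists_chart_frame_dual_derivations (k : Type) [Field k] [IsAlgClosed k] :
    ∀ (O : Type) [CommRing O] [IsDomain O] [IsDiscreteValuationRing O] [IsAdicComplete (IsLocalRing.maximalIdeal O) O]
        [IsAlgClosed (IsLocalRing.ResidueField O)] (θ : O →+* k), Function.Surjective θ →
      (letI := MvPolynomial.gradedAlgebra (σ := Fin (3 + 1)) (R := O); letI := MvPolynomial.gradedAlgebra (σ := Fin (3 + 1)) (R := k);
       ∀ (φ : MvPolynomial.homogeneousSubmodule (Fin (3 + 1)) O →+*ᵍ MvPolynomial.homogeneousSubmodule (Fin (3 + 1)) k)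
        (hφ' : HomogeneousIdeal.irrelevant (MvPolynomial.homogeneousSubmodule (Fin (3 + 1)) k) ≤ (HomogeneousIdeal.irrelevant (MvPolynomial.homogeneousSubmodule (Fin (3 + 1)) O)).map φ), (∀ s, φ s = MvPolynomial.map θ s) →
        AlgebraicGeometry.IsIntegral (AlgebraicGeometry.Proj (MvPolynomial.homogeneousSubmodule (Fin (3 + 1)) O)) → IsLocallyNoetherian (AlgebraicGeometry.Proj (MvPolynomial.homogeneousSubmodule (Fin (3 + 1)) O)) → Literature.AlgebraicGeometry.Resolution.Scheme.IsRegular (AlgebraicGeometry.Proj (MvPolynomial.homogeneousSubmodule (Fin (3 + 1)) O)) → AlgebraicGeometry.IsProper (AlgebraicGeometry.Proj.toSpecZero (MvPolynomial.homogeneousSubmodule (Fin (3 + 1)) O) ≫ AlgebraicGeometry.Spec.map (CommRingCat.ofHom (algebraMap O (MvPolynomial.homogeneousSubmodule (Fin (3 + 1)) O 0)))) → AlgebraicGeometry.SmoothOfRelativeDimension 3 (AlgebraicGeometry.Proj.toSpecZero (MvPolynomial.homogeneousSubmodule (Fin (3 + 1)) O) ≫ AlgebraicGeometry.Spec.map (CommRingCat.ofHom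 (algebraMap O (MvPolynomial.homogeneousSubmodule (Fin (3 + 1)) O 0)))) →
      -- the door's `ℓ`, `Z` and the CERTIFICATE data (`EqCertAt₀ k 3 ℓ Z hZ` unpacked)
      ∀ (ℓ : MvPolynomial (Fin (3 + 1)) k) (Z : Set (Literature.AlgebraicGeometry.Motives.projectiveSpace 3 k).left) (hZ : IsClosed Z) (e δ : ℕ) (g : MvPolynomial (Fin (3 + 1)) k)
        (B : Fin (3 + 1) → Fin 3 → k) (c a b : Fin 3) (v : Fin δ → Fin 3 → k) (r : Fin 3 → Fin (3 + 1)),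
        g.IsHomogeneous e → Squarefree (restrictToHyperplane B g) →
        Z = {y : (Literature.AlgebraicGeometry.Motives.projectiveSpace 3 k).left | ℓ ∈ (y : ProjectiveSpectrum (MvPolynomial.homogeneousSubmodule (Fin (3 + 1)) k)).asHomogeneousIdeal ∧ g ∈ (y : ProjectiveSpectrum (MvPolynomial.homogeneousSubmodule (Fin (3 + 1)) k)).asHomogeneousIdeal} →
        restrictToHyperplane B ℓ = 0 → Function.Injective r → ((c : ℕ) = 2 ∧ (a : ℕ) = 0 ∧ (b : ℕ) = 1) →
        (∀ i, v i c = 1 ∧ MvPolynomial.eval (v i) (restrictToHyperplane B g) = 0 ∧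
          (∀ j, MvPolynomial.eval (v i) (MvPolynomial.pderiv j (restrictToHyperplane B g)) = 0) ∧ hessBlock (restrictToHyperplane B g) a b (v i) ≠ 0) →
        (∀ z : ↥(redSub (Literature.AlgebraicGeometry.Motives.projectiveSpace 3 k).left Z hZ), IsClosed ({z} : Set ↥(redSub (Literature.AlgebraicGeometry.Motives.projectiveSpace 3 k).left Z hZ)) → ¬ IsRegularLocalRing ((redSub (Literature.AlgebraicGeometry.Motives.projectiveSpace 3 k).left Z hZ).presheaf.stalk z) →
          ∃ i, IsCoordVecOf k 3 (fun s => ∑ j, B s j * v i j) (redSubι (Literature.AlgebraicGeometry.Motives.projectiveSpace 3 k).left Z hZ z : (Literature.AlgebraicGeometry.Motives.projectiveSpace 3 k).left)) →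
        Function.Injective v →
      -- the LIFTED HYPERPLANE data (✓ `HyperplaneLift.exists_hyperplane_lift`)
      ∀ (a₀ : Fin (3 + 1)) (Bt : Fin (3 + 1) → Fin 3 → O) (ct : Fin (3 + 1) → O) (Nt : Fin 3 → Fin 3 → O),
        (∀ j, r j ≠ a₀) → (∀ a' j, θ (Bt a' j) = B a' j) → IsUnit (Matrix.of fun j j' : Fin 3 => Bt (r j) j').det → ct a₀ = 1 →
        MvPolynomial.aeval (fun a' : Fin (3 + 1) => ∑ j : Fin 3, MvPolynomial.C (Bt a' j) * MvPolynomial.X j) (∑ a, MvPolynomial.C (ct a) * MvPolynomial.X a : MvPolynomial (Fin (3 + 1)) O) = 0 →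
        (∀ G : MvPolynomial (Fin 3) O, MvPolynomial.aeval (fun a' : Fin (3 + 1) => ∑ j : Fin 3, MvPolynomial.C (Bt a' j) * MvPolynomial.X j)
          (MvPolynomial.aeval (fun i : Fin 3 => ∑ j : Fin 3, MvPolynomial.C (Nt i j) * MvPolynomial.X (r j)) G) = G) →
        (∀ f : MvPolynomial (Fin (3 + 1)) O, MvPolynomial.aeval (fun a' : Fin (3 + 1) => ∑ j : Fin 3, MvPolynomial.C (Bt a' j) * MvPolynomial.X j) f = 0 → (∑ a, MvPolynomial.C (ct a) * MvPolynomial.X a : MvPolynomial (Fin (3 + 1)) O) ∣ f) →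
        {y : (Literature.AlgebraicGeometry.Motives.projectiveSpace 3 k).left | ℓ ∈ (y : ProjectiveSpectrum (MvPolynomial.homogeneousSubmodule (Fin (3 + 1)) k)).asHomogeneousIdeal} = {y : (Literature.AlgebraicGeometry.Motives.projectiveSpace 3 k).left | (∑ a', MvPolynomial.C (θ (ct a')) * MvPolynomial.X a' : MvPolynomial (Fin (3 + 1)) k) ∈ (y : ProjectiveSpectrum (MvPolynomial.homogeneousSubmodule (Fin (3 + 1)) k)).asHomogeneousIdeal} →
      -- the EQUINODAL LIFT (✓ `exists_equinodal_lift_of_cert_of_surjective`)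
      ∀ (Gt : MvPolynomial (Fin 3) O) (nO : Fin δ → Fin 3 → O),
        Gt.IsHomogeneous e → MvPolynomial.map θ Gt = restrictToHyperplane B g → (∀ i j, θ (nO i j) = v i j) → (∀ i, nO i 2 = 1) →
        (∀ i, MvPolynomial.eval (nO i) Gt = 0 ∧ ∀ j, MvPolynomial.eval (nO i) (MvPolynomial.pderiv j Gt) = 0) →
        (∀ i, IsUnit (MvPolynomial.eval (nO i) (MvPolynomial.pderiv 0 (MvPolynomial.pderiv 0 Gt)) * MvPolynomial.eval (nO i) (MvPolynomial.pderiv 1 (MvPolynomial.pderiv 1 Gt))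
          - MvPolynomial.eval (nO i) (MvPolynomial.pderiv 0 (MvPolynomial.pderiv 1 Gt)) ^ 2)) →
      -- the two models' degree certificates (so the ideal sheaves below are well-formed)
      ∀ (hL : ∀ l, (![(∑ a, MvPolynomial.C (ct a) * MvPolynomial.X a : MvPolynomial (Fin (3 + 1)) O)] : Fin 1 → MvPolynomial (Fin (3 + 1)) O) l ∈ MvPolynomial.homogeneousSubmodule (Fin (3 + 1)) O ((![1] : Fin 1 → ℕ) l))
        (hF : ∀ l, (![(∑ a, MvPolynomial.C (ct a) * MvPolynomial.X a : MvPolynomial (Fin (3 + 1)) O), (MvPolynomial.aeval (fun i : Fin 3 => ∑ j : Fin 3, MvPolynomial.C (Nt i j) * MvPolynomial.X (r j)) Gt : MvPolynomial (Fin (3 + 1)) O)] : Fin 2 → MvPolynomial (Fin (3 + 1)) O) l ∈ MvPolynomial.homogeneousSubmodule (Fin (3 + 1)) O ((![1, e] : Fin 2 → ℕ) l)),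
      -- the NODE SECTIONS `𝔰 i = [av i]`, `av i = uᵢ⁻¹ • B̃·nO i` (✓ SectionOfVec), and the marked closed points `w i`
      ∀ (av : Fin δ → Fin (3 + 1) → O) (dv : Fin δ → Fin (3 + 1)) (hav : ∀ i, av i (dv i) = 1),
        (∀ i, ∃ u : O, IsUnit u ∧ ∀ a', u * av i a' = ∑ j : Fin 3, Bt a' j * nO i j) →
      ∀ (𝔰 : Fin δ → (AlgebraicGeometry.Spec (.of O) ⟶ (AlgebraicGeometry.Proj (MvPolynomial.homogeneousSubmodule (Fin (3 + 1)) O)))),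
        (∀ i, 𝔰 i = (AlgebraicGeometry.Spec.map (CommRingCat.ofHom ((Localization.awayLift (MvPolynomial.eval (av i)) (MvPolynomial.X (dv i) : MvPolynomial (Fin (3 + 1)) O)
            (SectionOfVec.isUnit_eval_X (av i) (dv i) (hav i))).comp
          (algebraMap (HomogeneousLocalization.Away (MvPolynomial.homogeneousSubmodule (Fin (3 + 1)) O) (MvPolynomial.X (dv i) : MvPolynomial (Fin (3 + 1)) O))
            (Localization.Away (MvPolynomial.X (dv i) : MvPolynomial (Fin (3 + 1)) O))))) ≫
          AlgebraicGeometry.Proj.awayι (MvPolynomial.homogeneousSubmodule (Fin (3 + 1)) O) (MvPolynomial.X (dv i)) (MvPolynomial.isHomogeneous_X O (dv i)) one_pos)) →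
      ∀ (w : Fin δ → (Literature.AlgebraicGeometry.Motives.projectiveSpace 3 k).left), (∀ i, (AlgebraicGeometry.Proj.map φ hφ' : (Literature.AlgebraicGeometry.Motives.projectiveSpace 3 k).left ⟶ (AlgebraicGeometry.Proj (MvPolynomial.homogeneousSubmodule (Fin (3 + 1)) O))) (w i) = 𝔰 i (IsLocalRing.closedPoint O)) →
      ∀ (i : Fin δ) (hFr : ∀ l, (![(∑ a, MvPolynomial.C (ct a) * MvPolynomial.X a : MvPolynomial (Fin (3 + 1)) O), (fun i : Fin 3 => ∑ j : Fin 3, MvPolynomial.C (Nt i j) * MvPolynomial.X (r j)) 0 - MvPolynomial.C (nO i 0) * (fun i : Fin 3 => ∑ j : Fin 3, MvPolynomial.C (Nt i j) * MvPolynomial.X (r j)) 2, (fun i : Fin 3 => ∑ j : Fin 3, MvPolynomial.C (Nt i j) * MvPolynomial.X (r j)) 1 - MvPolynomial.C (nO i 1) * (fun i : Fin 3 => ∑ j : Fin 3, MvPolynomial.C (Nt i j) * MvPolynomial.X (r j)) 2] : Fin 3 → MvPolynomial (Fin (3 + 1)) O) l ∈ MvPolynomial.homogeneousSubmodule (Fin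 (3 + 1)) O ((fun _ => 1 : Fin 3 → ℕ) l)),
        (letI := Literature.AlgebraicGeometry.Motives.ProjBaseChange.algebraBase (R := O) (MvPolynomial.homogeneousSubmodule (Fin (3 + 1)) O)
          (Submonoid.powers (MvPolynomial.X (dv i) : MvPolynomial (Fin (3 + 1)) O));
        ∃ E : Fin 3 → Derivation ℤ (MvPolynomial (Fin 3) O) (MvPolynomial (Fin 3) O),
          ∀ j l, E j (Literature.AlgebraicGeometry.Motives.ProjectiveSpace.chartAlgEquiv O (dv i)
            (Literature.AlgebraicGeometry.Resolution.mk₁ (MvPolynomial.homogeneousSubmodule (Fin (3 + 1)) O) (MvPolynomial.isHomogeneous_X O (dv i)) 1 ((![(∑ a, MvPolynomial.C (ct a) * MvPolynomial.X a : MvPolynomial (Fin (3 + 1)) O), (fun i : Fin 3 => ∑ j : Fin 3, MvPolynomial.C (Nt i j) * MvPolynomial.X (r j)) 0 - MvPolynomial.C (nO i 0) * (fun i : Fin 3 => ∑ j : Fin 3, MvPolynomial.C (Nt i j) * MvPolynomial.X (r j)) 2, (fun i : Fin 3 => ∑ j : Fin 3, MvPolynomial.C (Nt i j) * MvPolynomial.X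 (r j)) 1 - MvPolynomial.C (nO i 1) * (fun i : Fin 3 => ∑ j : Fin 3, MvPolynomial.C (Nt i j) * MvPolynomial.X (r j)) 2] : Fin 3 → MvPolynomial (Fin (3 + 1)) O) l) (hFr l))) =
            if j = l then 1 else 0)) := by
  intro O _ _ _ _ _ θ hθ
  letI := MvPolynomial.gradedAlgebra (σ := Fin (3 + 1)) (R := O)
  letI := MvPolynomial.gradedAlgebra (σ := Fin (3 + 1)) (R := k)
  intro φ hφ' hφ hPint hPnoeth hPreg hqprop hqsm ℓ Z hZ e δ g B c a b v r hg hsqf hZeq hℓB hr hcab hmarked hcover hvinj a₀ Bt ct Nt ha₀ hBt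
    hdet hcta₀ hψt hsect hkert hVℓ Gt nO hGt hGtred hnOv hnO2 hnode hhess hL hF av dv hav hunit 𝔰 h𝔰 w hw i hFr
  classical
  letI := Literature.AlgebraicGeometry.Motives.ProjBaseChange.algebraBase (R := O) (MvPolynomial.homogeneousSubmodule (Fin (3 + 1)) O)
    (Submonoid.powers (X (dv i) : MvPolynomial (Fin (3 + 1)) O))
  obtain ⟨u₀, hu₀, huav⟩ := hunit i
  -- the linear forms and the key form
  set Lt : MvPolynomial (Fin (3 + 1)) O := ∑ a, C (ct a) * X a with hLt
  set yt : Fin 3 → MvPolynomial (Fin (3 + 1)) O := fun t => ∑ j : Fin 3, C (Nt t j) * X (r j) with hyt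
  have hyt1 : ∀ t, yt t ∈ homogeneousSubmodule (Fin (3 + 1)) O 1 := fun t =>
    (mem_homogeneousSubmodule _ _).mpr (HyperplaneAlg.isHomogeneous_sum_C_mul_X _ _)
  have hLt1 : Lt ∈ homogeneousSubmodule (Fin (3 + 1)) O 1 := (mem_homogeneousSubmodule _ _).mpr (HyperplaneAlg.isHomogeneous_sum_C_mul_X ct id)
  have hm1 : ∀ t : Fin 3, yt t - C (nO i t) * yt 2 ∈ homogeneousSubmodule (Fin (3 + 1)) O 1 := fun t =>
    (mem_homogeneousSubmodule _ _).mpr ((HyperplaneAlg.isHomogeneous_sum_C_mul_X _ _).sub ((HyperplaneAlg.isHomogeneous_sum_C_mul_X _ _).C_mul _))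
  have hfr := SectionFrame.span_X_sub_eq_span_frame Bt ct Nt r a₀ hcta₀ hψt hsect hkert (nO i) (hnO2 i) (av i) (dv i) (hav i) u₀ hu₀ huav
  -- ### the chart ring `T = O[t₁,t₂,t₃] ≅ (O[x]_{x_d})₀` and the affine frame `(ℓ′, ū′, v̄′)`
  set e₀ := Literature.AlgebraicGeometry.Motives.ProjectiveSpace.chartAlgEquiv O (dv i) (n := 3) with he₀def
  have he₀mk : ∀ (m : ℕ) (Fp : MvPolynomial (Fin (3 + 1)) O) (hFp : Fp ∈ homogeneousSubmodule (Fin (3 + 1)) O m),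
      e₀ (mk₁ (homogeneousSubmodule (Fin (3 + 1)) O) (isHomogeneous_X O (dv i)) m Fp hFp) =
        Literature.AlgebraicGeometry.Motives.ProjectiveSpace.dehomogenize O (dv i) Fp := by
    intro m Fp hFp
    exact Literature.AlgebraicGeometry.Motives.ProjectiveSpace.ofChartRingHom_mk (dv i) m Fp _
  -- coefficient vectors of the three linear forms
  obtain ⟨αv, hαv⟩ : ∃ αv : Fin 3 → Fin (3 + 1) → O, αv = ![ct, fun a' => ∑ j : Fin 3, if r j = a' then (Nt 0 j - nO i 0 * Nt 2 j) else 0,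
    fun a' => ∑ j : Fin 3, if r j = a' then (Nt 1 j - nO i 1 * Nt 2 j) else 0] := ⟨_, rfl⟩
  have hreidx : ∀ γ : Fin 3 → O, (∑ j : Fin 3, C (γ j) * X (r j) : MvPolynomial (Fin (3 + 1)) O) =
      ∑ a', C (∑ j : Fin 3, if r j = a' then γ j else 0) * X a' := by
    intro γ
    have h1 : ∀ a', (C (∑ j : Fin 3, if r j = a' then γ j else 0) * X a' : MvPolynomial (Fin (3 + 1)) O) =
        ∑ j : Fin 3, if r j = a' then C (γ j) * X a' else 0 := by
      intro a'
      rw [map_sum, Finset.sum_mul]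
      refine Finset.sum_congr rfl fun j _ => ?_
      split_ifs <;> simp
    simp_rw [h1]
    rw [Finset.sum_comm]
    refine Finset.sum_congr rfl fun j _ => ?_
    rw [Finset.sum_ite_eq]
    simp
  have hframeα : ∀ l, (![Lt, yt 0 - C (nO i 0) * yt 2, yt 1 - C (nO i 1) * yt 2] : Fin 3 → MvPolynomial (Fin (3 + 1)) O) l =
      ∑ a', C (αv l a') * X a' := by
    have hm : ∀ t : Fin 3, yt t - C (nO i t) * yt 2 = ∑ j : Fin 3, C (Nt t j - nO i t * Nt 2 j) * X (r j) := by
      intro t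
      simp only [hyt]
      rw [Finset.mul_sum, ← Finset.sum_sub_distrib]
      refine Finset.sum_congr rfl fun j _ => ?_
      rw [map_sub, map_mul]; ring
    intro l; fin_cases l
    · rw [hαv]; rfl
    · rw [hαv]; exact (hm 0).trans (hreidx _)
    · rw [hαv]; exact (hm 1).trans (hreidx _)
  have hC : ∀ c' : O, Literature.AlgebraicGeometry.Motives.ProjectiveSpace.dehomogenize O (dv i) (n := 3) (C c') = C c' := fun c' =>
    (Literature.AlgebraicGeometry.Motives.ProjectiveSpace.dehomogenize O (dv i)).commutes c'
  have hdeh : ∀ γ : Fin (3 + 1) → O, Literature.AlgebraicGeometry.Motives.ProjectiveSpace.dehomogenize O (dv i) (∑ a', C (γ a') * X a') =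
      ∑ m, C (γ ((dv i).succAbove m)) * X m + C (γ (dv i)) := by
    intro γ
    rw [map_sum, Fin.sum_univ_succAbove _ (dv i), add_comm]
    simp only [map_mul, hC, Literature.AlgebraicGeometry.Motives.ProjectiveSpace.dehomogenize_X_self,
      Literature.AlgebraicGeometry.Motives.ProjectiveSpace.dehomogenize_X_succAbove, mul_one]
  obtain ⟨M, hMdef⟩ : ∃ M : Matrix (Fin 3) (Fin 3) O, M = fun l m => αv l ((dv i).succAbove m) := ⟨_, rfl⟩
  obtain ⟨cvec, hcvec⟩ : ∃ cvec : Fin 3 → O, cvec = fun l => αv l (dv i) := ⟨_, rfl⟩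
  obtain ⟨apt, hapt⟩ : ∃ apt : Fin 3 → O, apt = fun m => av i ((dv i).succAbove m) := ⟨_, rfl⟩
  have hFT : ∀ l, e₀ (mk₁ (homogeneousSubmodule (Fin (3 + 1)) O) (isHomogeneous_X O (dv i)) 1
      ((![Lt, yt 0 - C (nO i 0) * yt 2, yt 1 - C (nO i 1) * yt 2] : Fin 3 → MvPolynomial (Fin (3 + 1)) O) l) (hFr l)) =
      ∑ m', C (M l m') * X m' + C (cvec l) := by
    intro l
    rw [he₀mk, hframeα, hdeh, hMdef, hcvec]
  -- the frame vanishes at the section point: `F_l(a) = 0`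
  have hevα : ∀ l, MvPolynomial.eval (av i) ((![Lt, yt 0 - C (nO i 0) * yt 2, yt 1 - C (nO i 1) * yt 2] : Fin 3 → MvPolynomial (Fin (3 + 1)) O) l) = 0 := by
    have hL0 : MvPolynomial.eval (av i) Lt = 0 := by
      have h1 := SectionFrame.pow_mul_eval_eq_eval_aeval Bt (nO i) (av i) u₀ huav Lt hLt1
      rw [pow_one, hLt, hψt, map_zero] at h1
      exact (hu₀.mul_right_eq_zero).mp h1
    have hyv : ∀ t : Fin 3, MvPolynomial.eval (av i) (yt t - C (nO i t) * yt 2) = 0 := by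
      intro t
      have h2 := SectionFrame.mul_eval_sect Bt Nt r (nO i) (av i) u₀ huav hsect 2
      have ht := SectionFrame.mul_eval_sect Bt Nt r (nO i) (av i) u₀ huav hsect t
      rw [hnO2 i] at h2
      apply (hu₀.mul_right_eq_zero).mp
      rw [map_sub, map_mul, eval_C, mul_sub, ht, mul_left_comm, h2, mul_one, sub_self]
    intro l; fin_cases l
    · exact hL0
    · exact hyv 0
    · exact hyv 1
  have hFa : ∀ l, ∑ m, M l m * apt m + cvec l = 0 := by
    intro l
    have h1 := hevα l
    rw [hframeα l, map_sum, Fin.sum_univ_succAbove _ (dv i)] at h1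
    simp only [map_mul, eval_C, eval_X, hav i, mul_one] at h1
    rw [add_comm] at h1
    rw [hMdef, hapt, hcvec]
    exact h1
  -- `X_m − a_m ∈ (F₀, F₁, F₂)` in `T`: dehomogenise ✓ `SectionFrame.span_X_sub_eq_span_frame`
  have hspan : ∀ m, (X m - C (apt m) : MvPolynomial (Fin 3) O) ∈
      Ideal.span (Set.range fun l => (∑ m', C (M l m') * X m' + C (cvec l) : MvPolynomial (Fin 3) O)) := by
    intro m
    obtain ⟨Dh, hDh⟩ : ∃ Dh : MvPolynomial (Fin (3 + 1)) O →+* MvPolynomial (Fin 3) O,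
        Dh = (Literature.AlgebraicGeometry.Motives.ProjectiveSpace.dehomogenize O (dv i) (n := 3)).toRingHom := ⟨_, rfl⟩
    have hXm : (X m - C (apt m) : MvPolynomial (Fin 3) O) = Dh (X ((dv i).succAbove m) - C (av i ((dv i).succAbove m)) * X (dv i)) := by
      simp only [hDh, AlgHom.toRingHom_eq_coe, RingHom.coe_coe, map_sub, map_mul,
        Literature.AlgebraicGeometry.Motives.ProjectiveSpace.dehomogenize_X_succAbove,
        Literature.AlgebraicGeometry.Motives.ProjectiveSpace.dehomogenize_X_self, mul_one, hapt, hC]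
    have hmem : (X ((dv i).succAbove m) - C (av i ((dv i).succAbove m)) * X (dv i) : MvPolynomial (Fin (3 + 1)) O) ∈
        Ideal.span (Set.range ![Lt, yt 0 - C (nO i 0) * yt 2, yt 1 - C (nO i 1) * yt 2]) := by
      rw [← hfr]; exact Ideal.subset_span ⟨(dv i).succAbove m, rfl⟩
    have hmap := Ideal.mem_map_of_mem Dh hmem
    rw [Ideal.map_span, ← Set.range_comp] at hmap
    rw [hXm]
    have hrg : (Set.range (⇑Dh ∘ ![Lt, yt 0 - C (nO i 0) * yt 2, yt 1 - C (nO i 1) * yt 2])) =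
        Set.range fun l => (∑ m', C (M l m') * X m' + C (cvec l) : MvPolynomial (Fin 3) O) := by
      congr 1; funext l
      change Dh _ = _
      rw [← hFT l, he₀mk, hDh]; rfl
    rw [← hrg]; exact hmap
  obtain ⟨E, hE⟩ := SectionFrame.exists_dual_derivations_of_affine_frame M cvec apt hFa hspan
  refine ⟨E, fun j l => ?_⟩
  rw [← hE j l, ← hFT l]

end Summit.ResolutionOfSingularities.ResolutionOfSingularities.Cruxes.EquisingularLiftNat.Sections.Equinodal

end
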